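import Summits.QuantumFields.YangMills.Theorems.ColdStartUniversalityFeynmanKacHoeffdingForm
import Summits.QuantumFields.YangMills.Theorems.ColdStartUniversalityLatticeLangevinLezaudSkeletonUniform
import HarnessLib

/-!
# Route `ColdStartUniversality` (fixed-cut-off SZZ dynamics, sampler statistics): ★★★ THE SHARP HOEFFDING INEQUALITY FOR DISCRETE SAMPLES
# AT ANY SAMPLING INTERVAL — variance proxy `coth(λh/2)·b²` (León–Perron / Fan–Jiang–Sun), volume-free after the `O(log L)` burn-in, `|β'| < 1/12`

Helper file (seat `ym-line-csu-p1`, g37; `--supports stmt-QuantumFields-24809`).  SU(2) lattice Langevin dynamics of Shen–Zhu–Zhu at `(L, β')`,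
Wilson measure `μ = μ_{β'}`, realising kernel family `κ`, the `h`-SKELETON CHAIN `U_a, U_{a+h}, …, U_{a+nh}` of a strong solution after an
`L²`-warm time `a`.  `…LezaudSkeletonUniform` bounds its exponential moments with Lezaud's small-tilt form constant `m_h` (sharp as `h → 0`
only); here the León–Perron form bound (`…FeynmanKacHoeffdingForm`: secular equation + two-point reduction) gives the bound that is sharp
at EVERY step `h`, with `r = e^{−λh}` the form-contraction of `κ_h`:

* ★★★ `integral_exp_skeleton_sum_le_hoeffding` — gap `λ` + warm start `D` (hypotheses), `|V| ≤ b`, `μV = 0`, `0 ≤ s`, `h > 0`, every `n`: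
  `E exp(s Σ_{k≤n} V(U_{a+kh})) ≤ D · e^{sb} · exp(n · ((1+r)/(1−r)) · (sb)²/2)` — Hoeffding's lemma for the skeleton chain with the variance
  proxy `(1+r)/(1−r)·b² = coth(λh/2)·b²`;
* ★★★ `coldStart_skeleton_hoeffding_tail_uniform` — at `|β'| < 1/12` (`λ = 1 − 12|β'|`), after the burn-in `log B ≤ 2λt₀`, for EVERY bounded
  measurable `G` with `|G − μG| ≤ b`, every step `h > 0`, every `N = n+1` and `ε > 0`:
  `P[ N⁻¹ Σ_{k<N} G(U_{2+t₀+u+kh}) − μ_{β'}G ≥ ε ] ≤ e² · exp(−N · ((1 − e^{−λh})/(1 + e^{−λh})) · ε²/(2b²))`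
  — NO dependence on `L`; for `λh → ∞` this is Hoeffding's i.i.d. bound `exp(−Nε²/(2b²))` up to the prefactor, and for `h → 0` with
  `Nh = T` it is `exp(−λTε²/(4b²))`, the range-based (`σ ↦ b`) form of the continuous-time Bernstein bound.

[cite: LeonPerron2004, Theorem 1] [cite: Lezaud2001, Theorem 1.1] [cite: DiaconisSaloffcoste1996, Theorem 3.7].  THEOREMS ONLY, no definition,
no sorry.  HONEST FRAMING: RECORD-rung R3 plumbing at FIXED cut-off in LATTICE units; "volume-free" refers to `L` at fixed `|β'| < 1/12`; the
route's scaling `β'_K → ∞` leaves the window; `UniformColdStartMixing` (24809) is NOT restated; nothing K-uniform is proved; no crux, rung or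
summit statement is proved; the Yang–Mills mass gap is NOT proved.
-/

set_option autoImplicit false

noncomputable section

namespace Summit.QuantumFields.YangMills.Theorems.ColdStartUniversality

open MeasureTheory ProbabilityTheory Filter Set
open scoped BigOperators NNReal ENNReal
open Literature.Probability.Process Literature.MathematicalPhysics.QuantumFieldTheory
open Literature.MathematicalPhysics.QuantumLattice (fundamentalRep fundamentalLatticeRep continuous_fundamentalRep)

variable {L : ℕ} [NeZero L]

/-! ## §1. Hoeffding's lemma for the skeleton chain -/

/-- ★★★ **HOEFFDING'S LEMMA FOR THE `h`-SKELETON CHAIN (León–Perron variance proxy).**  Let `κ` be a realising Markov kernel family of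
the SU(2) SZZ dynamics at `(L, β')` with `L²(μ_{β'})` gap `λ > 0` on bounded measurable observables, `U` a strong solution from a deterministic
start on ANY space whose law at the lattice time `a` is `L²`-warm with constant `D ≥ 0`, `V` measurable with `|V| ≤ b` (`b > 0`) and
`∫ V dμ = 0`, `0 ≤ s`, `h > 0`, `r := e^{−λh}`.  Then for every `n`

  `∫ exp(s · Σ_{k<n+1} V(U_{a+kh})) dP ≤ D · e^{sb} · exp(((1+r)/(1−r)) · (sb)²/2)ⁿ`

(Feynman–Kac skeleton formula, norm-from-form, form-sense contraction `r` of `κ_h`, and the León–Perron form bound `hoeffding_form_bound`).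
[cite: LeonPerron2004, Theorem 1] -/
theorem integral_exp_skeleton_sum_le_hoeffding (L : ℕ) [NeZero L] (β' : ℝ)
    (κ : ℝ≥0 → Kernel (GaugeConfig 3 L (Matrix.specialUnitaryGroup (Fin 2) ℂ))
      (GaugeConfig 3 L (Matrix.specialUnitaryGroup (Fin 2) ℂ))) [∀ t, IsMarkovKernel (κ t)]
    (hreal : ∀ (t : ℝ≥0) (x : GaugeConfig 3 L (Matrix.specialUnitaryGroup (Fin 2) ℂ))
        (Ω : Type) [MeasurableSpace Ω] (P : Measure Ω) [IsProbabilityMeasure P]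
        (W : ℝ≥0 → Ω → (Edge 3 L × NoiseIdx 2 → ℝ)) (hW : IsFlatBrownian W P)
        (U : ℝ≥0 → Ω → GaugeConfig 3 L (Matrix.specialUnitaryGroup (Fin 2) ℂ)),
        (∀ ω, U 0 ω = x) →
        (latticeLangevinDynamics (fundamentalLatticeRep 2) β').IsSolution (fundamentalRep (Fin 2))
          hW.natFiltration P W U →
        κ t x = P.map (U t))
    {lam : ℝ} (hlam : 0 < lam)
    (hgap : ∀ {G : GaugeConfig 3 L (Matrix.specialUnitaryGroup (Fin 2) ℂ) → ℝ}, Measurable G → ∀ {M : ℝ}, (∀ x, |G x| ≤ M) →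
      ∀ t : ℝ≥0, ∫ x, ((∫ y, G y ∂(κ t x)) - ∫ z, G z ∂(wilsonMeasure (d := 3) (L := L) (fundamentalRep (Fin 2)) β')) ^ 2
          ∂(wilsonMeasure (d := 3) (L := L) (fundamentalRep (Fin 2)) β') ≤
        Real.exp (-2 * lam * t) * ∫ x, (G x - ∫ z, G z ∂(wilsonMeasure (d := 3) (L := L) (fundamentalRep (Fin 2)) β')) ^ 2
          ∂(wilsonMeasure (d := 3) (L := L) (fundamentalRep (Fin 2)) β'))
    (x : GaugeConfig 3 L (Matrix.specialUnitaryGroup (Fin 2) ℂ))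
    {Ω : Type} [MeasurableSpace Ω] {P : Measure Ω} [IsProbabilityMeasure P]
    {W : ℝ≥0 → Ω → (Edge 3 L × NoiseIdx 2 → ℝ)} (hW : IsFlatBrownian W P)
    {U : ℝ≥0 → Ω → GaugeConfig 3 L (Matrix.specialUnitaryGroup (Fin 2) ℂ)} (hU0 : ∀ ω, U 0 ω = x)
    (hU : (latticeLangevinDynamics (fundamentalLatticeRep 2) β').IsSolution (fundamentalRep (Fin 2)) hW.natFiltration P W U)
    (a : ℝ≥0) {D : ℝ} (hD : 0 ≤ D)
    (hwarm : ∀ {φ : GaugeConfig 3 L (Matrix.specialUnitaryGroup (Fin 2) ℂ) → ℝ}, Measurable φ → ∀ {M : ℝ}, (∀ z, |φ z| ≤ M) →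
      |∫ ω, φ (U a ω) ∂P| ≤ D * (∫ z, φ z ^ 2 ∂(wilsonMeasure (d := 3) (L := L) (fundamentalRep (Fin 2)) β')) ^ (1 / (2 : ℝ)))
    {V : GaugeConfig 3 L (Matrix.specialUnitaryGroup (Fin 2) ℂ) → ℝ} (hV : Measurable V) {b : ℝ} (hb : 0 < b)
    (hVb : ∀ z, |V z| ≤ b) (hV0 : ∫ z, V z ∂(wilsonMeasure (d := 3) (L := L) (fundamentalRep (Fin 2)) β') = 0)
    {s : ℝ} (hs : 0 ≤ s) (h : ℝ≥0) (hh : 0 < (h : ℝ)) (n : ℕ) :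
    ∫ ω, Real.exp (s * ∑ k ∈ Finset.range (n + 1), V (U (a + (k : ℝ≥0) * h) ω)) ∂P ≤
      D * Real.exp (s * b) *
        Real.exp ((1 + Real.exp (-(lam * h))) / (1 - Real.exp (-(lam * h))) * (s * b) ^ 2 / 2) ^ n := by
  classical
  set μ : Measure (GaugeConfig 3 L (Matrix.specialUnitaryGroup (Fin 2) ℂ)) :=
    wilsonMeasure (d := 3) (L := L) (fundamentalRep (Fin 2)) β' with hμ
  haveI : IsProbabilityMeasure μ :=
    isProbabilityMeasure_wilsonMeasure (d := 3) (L := L) (fundamentalRep (Fin 2)) (continuous_fundamentalRep (Fin 2)) β'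
  set r : ℝ := Real.exp (-(lam * h)) with hr
  set ε : ℝ := s with hε
  set m : ℝ := Real.exp ((1 + r) / (1 - r) * (ε * b) ^ 2 / 2) with hmdef
  have hr0 : 0 ≤ r := (Real.exp_pos _).le
  have hr1 : r < 1 := by rw [hr]; exact Real.exp_lt_one_iff.2 (by nlinarith)
  have hε0 : 0 ≤ ε := hs
  have hb0 : 0 ≤ b := hb.le
  have hm0 : 0 ≤ m := (Real.exp_pos _).le
  -- the weights `w = e^{εV/2}`, `φ = w² = e^{εV}`
  set w : GaugeConfig 3 L (Matrix.specialUnitaryGroup (Fin 2) ℂ) → ℝ := fun z => Real.exp (ε * V z / 2) with hw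
  have hεV : ∀ z, |ε * V z| ≤ ε * b := fun z => by
    rw [abs_mul, abs_of_nonneg hε0]; exact mul_le_mul_of_nonneg_left (hVb z) hε0
  have hwm : Measurable w := Real.measurable_exp.comp ((hV.const_mul ε).div_const 2)
  have hwpos : ∀ z, 0 < w z := fun z => Real.exp_pos _
  have hwb : ∀ z, |w z| ≤ Real.exp (ε * b / 2) := fun z => by
    rw [hw, abs_of_pos (Real.exp_pos _)]
    exact Real.exp_le_exp.2 (by linarith [(abs_le.1 (hεV z)).2])
  have hww : ∀ z, w z * w z = Real.exp (ε * V z) := fun z => by rw [hw, ← Real.exp_add]; congr 1; ring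
  have hφm : Measurable fun z => w z * w z := hwm.mul hwm
  have hφb : ∀ z, |w z * w z| ≤ Real.exp (ε * b) := fun z => by
    rw [hww, abs_of_pos (Real.exp_pos _)]; exact Real.exp_le_exp.2 (le_abs_self _ |>.trans (hεV z))
  -- step 1: `exp(θh Σ V) = ∏ φ(U_{a+kh})` and the skeleton formula with `Z = 1`
  have hexp : ∀ ω, Real.exp (s * ∑ k ∈ Finset.range (n + 1), V (U (a + (k : ℝ≥0) * h) ω)) =
      ∏ k ∈ Finset.range (n + 1), (w (U (a + (k : ℝ≥0) * h) ω) * w (U (a + (k : ℝ≥0) * h) ω)) := fun ω => by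
    rw [Finset.mul_sum, Real.exp_sum]
    exact Finset.prod_congr rfl fun k _ => by rw [hww]
  have hskel := integral_mul_prod_skeleton_eq (L := L) β' κ hreal x hW hU0 hU hφm hφb h (n + 1) a
    (measurable_const (a := (1 : ℝ))) (CZ := 1) (fun _ => by simp)
  simp only [one_mul] at hskel
  rw [show (fun ω => Real.exp (s * ∑ k ∈ Finset.range (n + 1), V (U (a + (k : ℝ≥0) * h) ω))) =
      fun ω => ∏ k ∈ Finset.range (n + 1), (w (U (a + (k : ℝ≥0) * h) ω) * w (U (a + (k : ℝ≥0) * h) ω)) from funext hexp, hskel,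
    skeleton_iterate_eq_sandwich (κ h) w n]
  -- step 2: the iterate `Sⁿ w` is bounded measurable; warm start on `ψ = w · Sⁿw`
  obtain ⟨hSm, hSb⟩ := FeynmanKac.sandwich_iterate_measurable_abs_le (κ h) hwm hwb hwm hwb n
  set Sw := (fun (f : GaugeConfig 3 L (Matrix.specialUnitaryGroup (Fin 2) ℂ) → ℝ)
    (z : GaugeConfig 3 L (Matrix.specialUnitaryGroup (Fin 2) ℂ)) => w z * ∫ y, w y * f y ∂(κ h z))^[n] w with hSw
  have hψm : Measurable fun z => w z * Sw z := hwm.mul hSm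
  have hψb : ∀ z, |w z * Sw z| ≤ Real.exp (ε * b / 2) * ((Real.exp (ε * b / 2) * Real.exp (ε * b / 2)) ^ n * Real.exp (ε * b / 2)) :=
    FeynmanKac.abs_mul_le_of_abs_le hwb hSb
  have hwarmψ := hwarm hψm hψb
  -- step 3: `∫ (w·Sⁿw)² dμ ≤ e^{εb} ∫ (Sⁿw)² ≤ e^{εb} m^{2n} ∫ w² ≤ (e^{εb} mⁿ)²`
  have hSym : ∀ {f g : GaugeConfig 3 L (Matrix.specialUnitaryGroup (Fin 2) ℂ) → ℝ}, Measurable f → (∃ C : ℝ, ∀ x, |f x| ≤ C) →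
      Measurable g → (∃ C : ℝ, ∀ x, |g x| ≤ C) →
      ∫ x, f x * (∫ y, g y ∂(κ h x)) ∂μ = ∫ x, g x * (∫ y, f y ∂(κ h x)) ∂μ :=
    fun hf hfb hg hgb => integral_mul_transition_symm_su2_of_measurable L β' κ hreal h hf hfb hg hgb
  have hPos : ∀ {g : GaugeConfig 3 L (Matrix.specialUnitaryGroup (Fin 2) ℂ) → ℝ}, Measurable g → (∃ C : ℝ, ∀ x, |g x| ≤ C) →
      0 ≤ ∫ x, g x * (∫ y, g y ∂(κ h x)) ∂μ := by
    intro g hg hgb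
    obtain ⟨C, hC⟩ := hgb
    rw [show h = h / 2 + h / 2 from (add_halves h).symm, integral_mul_transition_self_eq_sq_of_measurable L β' κ hreal (h / 2) hg hC]
    exact integral_nonneg fun x => sq_nonneg _
  have hForm : ∀ {g : GaugeConfig 3 L (Matrix.specialUnitaryGroup (Fin 2) ℂ) → ℝ}, Measurable g → (∃ C : ℝ, ∀ x, |g x| ≤ C) →
      ∫ x, (w x * g x) * (∫ y, w y * g y ∂(κ h x)) ∂μ ≤ m * ∫ x, g x ^ 2 ∂μ := by
    intro g hg hgb
    obtain ⟨C, hC⟩ := hgb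
    have hwg : Measurable fun z => w z * g z := hwm.mul hg
    have hwgb : ∀ z, |w z * g z| ≤ Real.exp (ε * b / 2) * C := FeynmanKac.abs_mul_le_of_abs_le hwb hC
    have h1 := transition_form_le_of_gap L β' κ hreal hgap hwg hwgb h
    have h2 := FeynmanKac.hoeffding_form_bound μ hV hb hVb hV0 hε0 hr0 hr1 hg hC
    have e1 : ∫ z, (w z * g z) ^ 2 ∂μ = ∫ z, Real.exp (ε * V z) * g z ^ 2 ∂μ :=
      integral_congr_ae (ae_of_all _ fun z => by
        show (w z * g z) ^ 2 = Real.exp (ε * V z) * g z ^ 2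
        rw [← hww z]; ring)
    have e2 : ∫ z, w z * g z ∂μ = ∫ z, Real.exp (ε * V z / 2) * g z ∂μ := rfl
    rw [e1, e2, ← hr] at h1
    rw [← hmdef] at h2
    have hsq : 0 ≤ (∫ z, Real.exp (ε * V z / 2) * g z ∂μ) ^ 2 := sq_nonneg _
    nlinarith [h1, h2, hr0, hr1.le]
  have hiter := FeynmanKac.integral_sq_sandwich_iterate_le μ (κ h) hSym hPos hwm hwb hm0 hForm hwm hwb n
  have hw2 : ∫ z, w z ^ 2 ∂μ ≤ Real.exp (ε * b) := by
    have hpt : ∀ z, w z ^ 2 ≤ Real.exp (ε * b) := fun z => by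
      rw [sq, hww]; exact Real.exp_le_exp.2 (le_abs_self _ |>.trans (hεV z))
    have := integral_mono (FeynmanKac.integrable_of_measurable_of_abs_le μ (hwm.pow_const 2) (B := Real.exp (ε * b))
      fun z => by rw [abs_of_nonneg (sq_nonneg _)]; exact hpt z) (integrable_const _) hpt
    rwa [integral_const, probReal_univ, one_smul] at this
  have hψ2 : ∫ z, (w z * Sw z) ^ 2 ∂μ ≤ (Real.exp (ε * b) * m ^ n) ^ 2 := by
    have hpt : ∀ z, (w z * Sw z) ^ 2 ≤ Real.exp (ε * b) * Sw z ^ 2 := fun z => by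
      rw [mul_pow, sq (w z), hww]
      exact mul_le_mul_of_nonneg_right (Real.exp_le_exp.2 (le_abs_self _ |>.trans (hεV z))) (sq_nonneg _)
    have i1 : Integrable (fun z => (w z * Sw z) ^ 2) μ :=
      FeynmanKac.integrable_of_measurable_of_abs_le μ (hψm.pow_const 2) (B := (Real.exp (ε * b / 2) *
        ((Real.exp (ε * b / 2) * Real.exp (ε * b / 2)) ^ n * Real.exp (ε * b / 2))) ^ 2) fun z => by
        rw [abs_pow]; exact pow_le_pow_left₀ (abs_nonneg _) (hψb z) 2
    have i2 : Integrable (fun z => Sw z ^ 2) μ :=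
      FeynmanKac.integrable_of_measurable_of_abs_le μ (hSm.pow_const 2)
        (B := ((Real.exp (ε * b / 2) * Real.exp (ε * b / 2)) ^ n * Real.exp (ε * b / 2)) ^ 2) fun z => by
        rw [abs_pow]; exact pow_le_pow_left₀ (abs_nonneg _) (hSb z) 2
    calc ∫ z, (w z * Sw z) ^ 2 ∂μ ≤ ∫ z, Real.exp (ε * b) * Sw z ^ 2 ∂μ := integral_mono i1 (i2.const_mul _) hpt
      _ = Real.exp (ε * b) * ∫ z, Sw z ^ 2 ∂μ := integral_const_mul _ _
      _ ≤ Real.exp (ε * b) * (m ^ (2 * n) * ∫ z, w z ^ 2 ∂μ) := mul_le_mul_of_nonneg_left hiter (Real.exp_pos _).le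
      _ ≤ Real.exp (ε * b) * (m ^ (2 * n) * Real.exp (ε * b)) :=
          mul_le_mul_of_nonneg_left (mul_le_mul_of_nonneg_left hw2 (by positivity)) (Real.exp_pos _).le
      _ = (Real.exp (ε * b) * m ^ n) ^ 2 := by ring
  -- step 4: conclude
  have hroot : (∫ z, (w z * Sw z) ^ 2 ∂μ) ^ (1 / (2 : ℝ)) ≤ Real.exp (ε * b) * m ^ n := by
    rw [← Real.sqrt_eq_rpow]
    calc Real.sqrt (∫ z, (w z * Sw z) ^ 2 ∂μ) ≤ Real.sqrt ((Real.exp (ε * b) * m ^ n) ^ 2) := Real.sqrt_le_sqrt hψ2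
      _ = Real.exp (ε * b) * m ^ n := Real.sqrt_sq (by positivity)
  calc ∫ ω, w (U a ω) * Sw (U a ω) ∂P ≤ |∫ ω, w (U a ω) * Sw (U a ω) ∂P| := le_abs_self _
    _ ≤ D * (∫ z, (w z * Sw z) ^ 2 ∂μ) ^ (1 / (2 : ℝ)) := hwarmψ
    _ ≤ D * (Real.exp (ε * b) * m ^ n) := mul_le_mul_of_nonneg_left hroot hD
    _ = D * Real.exp (s * b) * m ^ n := by rw [hε]; ring


/-! ## §2. The sharp Hoeffding tail for discrete samples, `|β'| < 1/12` -/

/-- ★★★ **THE SHARP HOEFFDING INEQUALITY FOR DISCRETE SAMPLES OF THE COLD-START SAMPLER AT ANY SAMPLING INTERVAL — VOLUME-FREE after the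
`O(log L)` burn-in, `|β'| < 1/12`.**  For every `L`, `|β'| < 1/12` (`λ := 1 − 12|β'|`), every deterministic start `z`, EVERY strong solution
`U` from `z` on ANY filtered probability space, EVERY bounded measurable `G` with `|G − μ_{β'}G| ≤ b` (`b > 0`), all `t₀, u` with
`log B ≤ 2λt₀`, every step `h > 0` (`r := e^{−λh}`), every `n` (`N = n + 1` samples) and every `ε > 0`:

  `P[ (n+1)⁻¹ Σ_{k<n+1} G(U_{2+t₀+u+kh}) − ∫ G dμ_{β'} ≥ ε ] ≤ e² · exp(−(n+1) · ((1 − r)/(1 + r)) · ε²/(2b²))`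

— the León–Perron / Fan–Jiang–Sun variance proxy `(1+r)/(1−r)·b² = coth(λh/2)·b²`; NO dependence on `L` (Markov's inequality on
`integral_exp_skeleton_sum_le_hoeffding` at `s = ((1−r)/(1+r))·ε/b²`, warm start `coldStart_warmStart_uniform`, gap
`wilson_spectralGap_uniform_measurable`). [cite: LeonPerron2004, Theorem 1] [cite: DiaconisSaloffcoste1996, Theorem 3.7] -/
theorem coldStart_skeleton_hoeffding_tail_uniform (L : ℕ) [NeZero L] (β' : ℝ) (hβ : |β'| < 1 / 12)
    (z : GaugeConfig 3 L (Matrix.specialUnitaryGroup (Fin 2) ℂ))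
    {Ω : Type} [MeasurableSpace Ω] {P : Measure Ω} [IsProbabilityMeasure P]
    {W : ℝ≥0 → Ω → (Edge 3 L × NoiseIdx 2 → ℝ)} (hW : IsFlatBrownian W P)
    {U : ℝ≥0 → Ω → GaugeConfig 3 L (Matrix.specialUnitaryGroup (Fin 2) ℂ)} (hU0 : ∀ ω, U 0 ω = z)
    (hU : (latticeLangevinDynamics (fundamentalLatticeRep 2) β').IsSolution (fundamentalRep (Fin 2)) hW.natFiltration P W U)
    {G : GaugeConfig 3 L (Matrix.specialUnitaryGroup (Fin 2) ℂ) → ℝ} (hG : Measurable G) {b : ℝ} (hb : 0 < b)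
    (hGb : ∀ x, |G x - ∫ y, G y ∂(wilsonMeasure (d := 3) (L := L) (fundamentalRep (Fin 2)) β')| ≤ b) (t₀ u h : ℝ≥0)
    (ht₀ : Real.log (96 * |β'| * (Fintype.card (Edge 3 L) : ℝ) + 10 * |β'| * (Fintype.card (Plaquette 3 L) : ℝ) + Real.log 2 +
      (Fintype.card (Edge 3 L) : ℝ) * Real.log (3 / 2)) ≤ 2 * (1 - 12 * |β'|) * t₀)
    (hh : 0 < (h : ℝ)) (n : ℕ) {ε : ℝ} (hε : 0 < ε) :
    P.real {ω | ε ≤ ((n : ℝ) + 1)⁻¹ * (∑ k ∈ Finset.range (n + 1), G (U (2 + t₀ + u + (k : ℝ≥0) * h) ω)) - ∫ y, G y ∂(wilsonMeasure (d := 3) (L := L) (fundamentalRep (Fin 2)) β')} ≤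
      Real.exp 2 * Real.exp (-(((n : ℝ) + 1) * ((1 - Real.exp (-((1 - 12 * |β'|) * h))) / (1 + Real.exp (-((1 - 12 * |β'|) * h)))) *
        ε ^ 2 / (2 * b ^ 2))) := by
  classical
  haveI : IsProbabilityMeasure (wilsonMeasure (d := 3) (L := L) (fundamentalRep (Fin 2)) β') :=
    isProbabilityMeasure_wilsonMeasure (d := 3) (L := L) (fundamentalRep (Fin 2)) (continuous_fundamentalRep (Fin 2)) β'
  set lam : ℝ := 1 - 12 * |β'| with hlamdef
  have hlam : 0 < lam := by rw [hlamdef]; linarith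
  set m : ℝ := ∫ y, G y ∂(wilsonMeasure (d := 3) (L := L) (fundamentalRep (Fin 2)) β') with hm
  set r : ℝ := Real.exp (-(lam * h)) with hr
  have hr0 : 0 < r := Real.exp_pos _
  have hr1 : r < 1 := by rw [hr]; exact Real.exp_lt_one_iff.2 (by nlinarith)
  set κq : ℝ := (1 + r) / (1 - r) with hκq
  have hκq1 : 1 ≤ κq := by rw [hκq, le_div_iff₀ (by linarith)]; linarith
  have hκq0 : 0 < κq := by linarith
  -- the empirical mean: large deviations `ε > b` are impossible
  by_cases hεb : b < ε
  · have hempty : {ω | ε ≤ ((n : ℝ) + 1)⁻¹ * (∑ k ∈ Finset.range (n + 1), G (U (2 + t₀ + u + (k : ℝ≥0) * h) ω)) - m} = ∅ := by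
      refine Set.eq_empty_iff_forall_notMem.2 fun ω hω => ?_
      simp only [Set.mem_setOf_eq] at hω
      have hn1 : (0 : ℝ) < (n : ℝ) + 1 := by positivity
      have hsum : ∑ k ∈ Finset.range (n + 1), G (U (2 + t₀ + u + (k : ℝ≥0) * h) ω) ≤ ((n : ℝ) + 1) * (m + b) := by
        calc ∑ k ∈ Finset.range (n + 1), G (U (2 + t₀ + u + (k : ℝ≥0) * h) ω) ≤ ∑ _k ∈ Finset.range (n + 1), (m + b) :=
              Finset.sum_le_sum fun k _ => by linarith [(abs_le.1 (hGb (U (2 + t₀ + u + (k : ℝ≥0) * h) ω))).2]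
          _ = ((n : ℝ) + 1) * (m + b) := by rw [Finset.sum_const, Finset.card_range, nsmul_eq_mul]; push_cast; ring
      have h2 : ((n : ℝ) + 1)⁻¹ * (∑ k ∈ Finset.range (n + 1), G (U (2 + t₀ + u + (k : ℝ≥0) * h) ω)) ≤ m + b := by
        rw [inv_mul_le_iff₀ hn1]; exact hsum
      linarith
    rw [hempty, measureReal_empty]; positivity
  push Not at hεb
  -- the tilt `s = ε/(κ b²)` and the exponential moment
  set s : ℝ := ε / (κq * b ^ 2) with hsdef
  have hs : 0 ≤ s := by positivity
  have hsb : s * b ≤ 1 := by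
    rw [hsdef, div_mul_eq_mul_div, div_le_one (by positivity)]
    nlinarith [mul_le_mul hκq1 hεb hε.le hκq0.le]
  obtain ⟨κ, hκM, -, hreal⟩ := exists_transitionKernel L β'
  haveI := hκM
  have hV : Measurable fun x => G x - m := hG.sub measurable_const
  obtain ⟨M, hM⟩ : ∃ M : ℝ, ∀ x, |G x| ≤ M :=
    ⟨b + |m|, fun x => by
      calc |G x| = |(G x - m) + m| := by ring_nf
        _ ≤ |G x - m| + |m| := abs_add_le _ _
        _ ≤ b + |m| := add_le_add (hGb x) le_rfl⟩
  have hV0 : ∫ x, (G x - m) ∂(wilsonMeasure (d := 3) (L := L) (fundamentalRep (Fin 2)) β') = 0 := by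
    rw [integral_sub (FeynmanKac.integrable_of_measurable_of_abs_le _ hG hM) (integrable_const m), integral_const, probReal_univ,
      one_smul, ← hm, sub_self]
  have hmgf := integral_exp_skeleton_sum_le_hoeffding L β' κ hreal hlam
    (fun hG' _ hM' t => wilson_spectralGap_uniform_measurable L β' hβ κ hreal hG' hM' t) z hW hU0 hU (2 + t₀ + u) (Real.exp_pos 1).le
    (fun hφ _ hφM => coldStart_warmStart_uniform L β' hβ z hW hU0 hU hφ hφM t₀ u ht₀) hV hb hGb hV0 hs h hh n
  rw [← hr] at hmgf
  -- Markov's inequality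
  have hmU : ∀ ρ : ℝ≥0, Measurable (U ρ) := fun ρ => (hU.adapted ρ).mono (hW.natFiltration.le ρ) le_rfl
  set F : Ω → ℝ := fun ω => Real.exp (s * ∑ k ∈ Finset.range (n + 1), (G (U (2 + t₀ + u + (k : ℝ≥0) * h) ω) - m)) with hF
  have hFm : Measurable F :=
    Real.measurable_exp.comp ((Finset.measurable_sum _ fun k _ => (hG.comp (hmU _)).sub measurable_const).const_mul _)
  have hFb : ∀ ω, |F ω| ≤ Real.exp (s * (((n : ℝ) + 1) * b)) := by
    intro ω
    rw [hF, abs_of_pos (Real.exp_pos _)]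
    refine Real.exp_le_exp.2 (mul_le_mul_of_nonneg_left ?_ hs)
    calc ∑ k ∈ Finset.range (n + 1), (G (U (2 + t₀ + u + (k : ℝ≥0) * h) ω) - m)
        ≤ ∑ _k ∈ Finset.range (n + 1), b := Finset.sum_le_sum fun k _ => (le_abs_self _).trans (hGb _)
      _ = ((n : ℝ) + 1) * b := by rw [Finset.sum_const, Finset.card_range, nsmul_eq_mul]; push_cast; ring
  have hFi : Integrable F P := FeynmanKac.integrable_of_measurable_of_abs_le P hFm hFb
  have hsub : {ω | ε ≤ ((n : ℝ) + 1)⁻¹ * (∑ k ∈ Finset.range (n + 1), G (U (2 + t₀ + u + (k : ℝ≥0) * h) ω)) - m} ⊆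
      {ω | Real.exp (s * ((n : ℝ) + 1) * ε) ≤ F ω} := by
    intro ω hω
    simp only [Set.mem_setOf_eq] at hω ⊢
    rw [hF]
    refine Real.exp_le_exp.2 ?_
    have hn1 : (0 : ℝ) < (n : ℝ) + 1 := by positivity
    have hsum : ∑ k ∈ Finset.range (n + 1), (G (U (2 + t₀ + u + (k : ℝ≥0) * h) ω) - m) =
        (∑ k ∈ Finset.range (n + 1), G (U (2 + t₀ + u + (k : ℝ≥0) * h) ω)) - ((n : ℝ) + 1) * m := by
      rw [Finset.sum_sub_distrib, Finset.sum_const, Finset.card_range, nsmul_eq_mul]; push_cast; ring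
    have hε' : ((n : ℝ) + 1) * ε ≤ (∑ k ∈ Finset.range (n + 1), G (U (2 + t₀ + u + (k : ℝ≥0) * h) ω)) - ((n : ℝ) + 1) * m := by
      have := mul_le_mul_of_nonneg_left hω hn1.le
      rwa [mul_sub, ← mul_assoc, mul_inv_cancel₀ hn1.ne', one_mul] at this
    rw [hsum]
    calc s * ((n : ℝ) + 1) * ε = s * (((n : ℝ) + 1) * ε) := by ring
      _ ≤ s * ((∑ k ∈ Finset.range (n + 1), G (U (2 + t₀ + u + (k : ℝ≥0) * h) ω)) - ((n : ℝ) + 1) * m) :=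
          mul_le_mul_of_nonneg_left hε' hs
  have hmarkov := mul_meas_ge_le_integral_of_nonneg (μ := P) (ae_of_all _ fun ω => (Real.exp_pos _).le) hFi
    (Real.exp (s * ((n : ℝ) + 1) * ε))
  have hexp0 : 0 < Real.exp (s * ((n : ℝ) + 1) * ε) := Real.exp_pos _
  have hint : ∫ ω, F ω ∂P ≤ Real.exp 1 * Real.exp (s * b) * Real.exp (κq * (s * b) ^ 2 / 2) ^ n := by rw [hF]; exact hmgf
  -- the algebra of the exponent
  have hpow : Real.exp (κq * (s * b) ^ 2 / 2) ^ n ≤ Real.exp (((n : ℝ) + 1) * (κq * (s * b) ^ 2 / 2)) := by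
    rw [← Real.exp_nat_mul]
    exact Real.exp_le_exp.2 (by nlinarith [sq_nonneg (s * b), hκq0.le, mul_nonneg hκq0.le (sq_nonneg (s * b))])
  have hkey : ((n : ℝ) + 1) * (κq * (s * b) ^ 2 / 2) - s * ((n : ℝ) + 1) * ε = -(((n : ℝ) + 1) * ((1 - r) / (1 + r)) * ε ^ 2 / (2 * b ^ 2)) := by
    have h1r : (1 : ℝ) - r ≠ 0 := by linarith
    have h1r' : (1 : ℝ) + r ≠ 0 := by linarith
    rw [hsdef, hκq]
    field_simp
    ring
  calc P.real {ω | ε ≤ ((n : ℝ) + 1)⁻¹ * (∑ k ∈ Finset.range (n + 1), G (U (2 + t₀ + u + (k : ℝ≥0) * h) ω)) - m}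
      ≤ P.real {ω | Real.exp (s * ((n : ℝ) + 1) * ε) ≤ F ω} := measureReal_mono hsub
    _ ≤ (∫ ω, F ω ∂P) / Real.exp (s * ((n : ℝ) + 1) * ε) := by rw [le_div_iff₀ hexp0, mul_comm]; exact hmarkov
    _ ≤ Real.exp 1 * Real.exp (s * b) * Real.exp (κq * (s * b) ^ 2 / 2) ^ n / Real.exp (s * ((n : ℝ) + 1) * ε) :=
        div_le_div_of_nonneg_right hint hexp0.le
    _ ≤ Real.exp 1 * Real.exp 1 * Real.exp (((n : ℝ) + 1) * (κq * (s * b) ^ 2 / 2)) / Real.exp (s * ((n : ℝ) + 1) * ε) := by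
        refine div_le_div_of_nonneg_right ?_ hexp0.le
        exact mul_le_mul (mul_le_mul_of_nonneg_left (Real.exp_le_exp.2 hsb) (Real.exp_pos 1).le) hpow (by positivity) (by positivity)
    _ = Real.exp 2 * Real.exp (((n : ℝ) + 1) * (κq * (s * b) ^ 2 / 2) - s * ((n : ℝ) + 1) * ε) := by
        rw [Real.exp_sub, ← Real.exp_add, mul_div_assoc]; norm_num
    _ = Real.exp 2 * Real.exp (-(((n : ℝ) + 1) * ((1 - r) / (1 + r)) * ε ^ 2 / (2 * b ^ 2))) := by rw [hkey]

end Summit.QuantumFields.YangMills.Theorems.ColdStartUniversality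

end
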